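import Summits.CriticalPhenomena.PercolationContinuityZ3.Theorems.PercNearOneGluingNoHeavyQuantGluedChildrenThree
import HarnessLib

/-!
# QUANT lane R8, T-DEC: THE SUB-FLOOR HUB OF A LIST OF FAR-GIANT PIECES — definition, law facts, support and LIKELIHOOD-RATIO DOMINANCE
# over `Bin(j, ·)` by induction on the list (census-1 gen 31; part 1 of "the hub of every width is SDEC")

builds on p205010 (kernel theorem, internal audit signed; external expert review pending)

Support + definition file (`--supports stmt-CriticalPhenomena-4575`), QUANT lane seat prim-quant-census-1 (gen 31); memo
`run/shared/lean/prim/quant/prim-quant-census-1/g31/HUB-GENERAL-G31.md`.  One definition (`cHub`, the hub of a LIST of piece gates, so that the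
width is a variable), theorems with standard axioms, no sorries.  Uses `cp_laws` / `lconv_laws` (census-1 g30 `…QuantGluedChildrenThree`).
Part 2 (`…QuantSubfloorHubGeneral`): the route bound and `sdec_cHub` (every width `≥ 2`) via the progression criterion `sdec_progression`.

THE OBJECT.  `cHub [] = δ₀`, `cHub (γ :: P) = cHub P ∗ C(γ)` (`lconv (3·|P|) 3`, `C(γ) = {1: 1−γ, 3: γ}` the far-giant piece); `cHub [γ₃, γ₂, γ₁]`
is g30's triple hub `TH[γ₁, γ₂, γ₃]` verbatim.  It is the law of `j + 2·(B₁ + … + B_j)`, `Bᵢ ~ Bern(γᵢ)` independent (`j = |P|`): atoms `j + 2s`,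
masses the Poisson-binomial weights `u_s`.

* `lconv_cp_apply` — `(F ∗ C(γ))(h) = (1−γ)·F(h−1) + γ·F(h−3)`;  `cHub_laws` — probability law on `{0..3j}`, mean `Σ (1 + 2γᵢ)`.
* **`cHub_struct`** — for any `o ≥ 0` with `o(1−γᵢ) ≤ γᵢ` for every `γᵢ ∈ P` (`o ≤` every odds): SUPPORT (`cHub P h ≠ 0 ⟹ h = j + 2s`, `s ≤ j`) and
  LIKELIHOOD-RATIO DOMINANCE `o·(3j − h)·u(h) ≤ (h + 2 − j)·u(h + 2)` for every `h` — in `s`-indexing `o·(j − s)·u_s ≤ (s + 1)·u_{s+1}`, i.e.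
  `u_s / C(j,s)` grows at least geometrically with ratio `o`.  The induction step: with `A = u(h−1)`, `B = u(h−3)`, `C = u(h+1)` the new masses are
  `(1−γ)A + γB` and `(1−γ)C + γA`, and `RHS − LHS ≥ 2A·(γ − o(1−γ)) ≥ 0` from the two instances of the hypothesis at `h − 1`, `h − 3`.

HONEST STATUS.  Tools; `SiblingStep`, `GluedDominated`, `SDECConvClosed`, `FarTreeRow` OPEN; RATE class (log\*) / honest sentence of
`run/shared/lean/prim/quant/README.md` unchanged.  [this work].  Likelihood-ratio ordering of Poisson-binomial laws is classical; nothing here is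
cited as a published result.  The gluing rows served [cite: KozmaNitzan2024, Conjecture 3 (p. 15)]; product measure [cite: Grimmett1999, §1.3 p. 10].
-/

noncomputable section

open scoped BigOperators

namespace Summit.CriticalPhenomena.PercolationContinuityZ3.Theorems
namespace Quant
namespace LawDec

open Finset

/-- the point mass `δ_K` -/
local notation3 "δ[" K "]" => (fun k : ℕ => if k = (K : ℕ) then (1 : ℝ) else 0)

/-- the FAR-GIANT PIECE `C(γ) = {1, 3; γ}`: one sure relay over an under-floor 2-blob at gate `γ` -/
local notation3 "CP[" a "]" => (fun h : ℕ => (1 - (a : ℝ)) * (if h = 1 then (1 : ℝ) else 0) + (a : ℝ) * (if h = 3 then (1 : ℝ) else 0))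

/-! ### The hub of a list of far-giant pieces -/

/-- **the sub-floor hub of a list of far-giant pieces**: `cHub [] = δ₀`, `cHub (γ :: P) = cHub P ∗ C(γ)` — the law of
`|P| + 2·Σ Bern(γᵢ)` (independent), on `{0..3|P|}`. [this work] -/
def cHub : List ℝ → ℕ → ℝ
  | [] => δ[0]
  | γ :: P => lconv (3 * P.length) 3 (cHub P) CP[γ]

/-- a shifted indicator sum. [this work] -/
private theorem sum_ite_shift (N d h : ℕ) (F : ℕ → ℝ) (hF : ∀ i, N < i → F i = 0) :
    ∑ i ∈ Finset.range (N + 1), (if i + d = h then F i else 0) = if d ≤ h then F (h - d) else 0 := by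
  by_cases hd : d ≤ h
  · rw [if_pos hd]
    have e : ∀ i, (if i + d = h then F i else 0) = (if i = h - d then F i else 0) := fun i => by
      by_cases hi : i + d = h
      · rw [if_pos hi, if_pos (show i = h - d by omega)]
      · rw [if_neg hi, if_neg (show ¬ (i = h - d) by omega)]
    simp_rw [e]
    rw [Finset.sum_ite_eq']
    split_ifs with hm
    · rfl
    · have : ¬ (h - d < N + 1) := fun hh => hm (Finset.mem_range.2 hh)
      exact (hF _ (by omega)).symm
  · rw [if_neg hd]
    exact Finset.sum_eq_zero fun i _ => by rw [if_neg (show ¬ (i + d = h) by omega)]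

/-- **`(F ∗ C(γ))(h) = (1−γ)·F(h−1) + γ·F(h−3)`** for `F` vanishing above `N`. [this work] -/
theorem lconv_cp_apply (N : ℕ) (F : ℕ → ℝ) (γ : ℝ) (hF : ∀ i, N < i → F i = 0) (h : ℕ) :
    lconv N 3 F CP[γ] h = (1 - γ) * (if 1 ≤ h then F (h - 1) else 0) + γ * (if 3 ≤ h then F (h - 3) else 0) := by
  simp only [lconv]
  have e : ∀ i ∈ Finset.range (N + 1), ∑ k ∈ Finset.range (3 + 1), (if i + k = h then F i * CP[γ] k else 0)
      = (1 - γ) * (if i + 1 = h then F i else 0) + γ * (if i + 3 = h then F i else 0) := by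
    intro i _
    rw [Finset.sum_range_succ, Finset.sum_range_succ, Finset.sum_range_succ, Finset.sum_range_succ, Finset.sum_range_zero,
      zero_add]
    have c0 : (1 - γ) * (if (0 : ℕ) = 1 then (1 : ℝ) else 0) + γ * (if (0 : ℕ) = 3 then (1 : ℝ) else 0) = 0 := by norm_num
    have c1 : (1 - γ) * (if (1 : ℕ) = 1 then (1 : ℝ) else 0) + γ * (if (1 : ℕ) = 3 then (1 : ℝ) else 0) = 1 - γ := by norm_num
    have c2 : (1 - γ) * (if (2 : ℕ) = 1 then (1 : ℝ) else 0) + γ * (if (2 : ℕ) = 3 then (1 : ℝ) else 0) = 0 := by norm_num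
    have c3 : (1 - γ) * (if (3 : ℕ) = 1 then (1 : ℝ) else 0) + γ * (if (3 : ℕ) = 3 then (1 : ℝ) else 0) = γ := by norm_num
    beta_reduce
    rw [c0, c1, c2, c3]
    by_cases h0 : i + 0 = h <;> by_cases h1 : i + 1 = h <;> by_cases h2 : i + 2 = h <;> by_cases h3 : i + 3 = h <;>
      simp only [h0, h1, h2, h3, if_true, if_false] <;> ring
  rw [Finset.sum_congr rfl e, Finset.sum_add_distrib, ← Finset.mul_sum, ← Finset.mul_sum,
    sum_ite_shift N 1 h F hF, sum_ite_shift N 3 h F hF]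

/-- **law facts of the hub**: nonnegative, vanishing above `3|P|`, mass `1`, mean `Σ (1 + 2γᵢ)`. [this work] -/
theorem cHub_laws : ∀ P : List ℝ, (∀ γ ∈ P, 0 ≤ γ ∧ γ ≤ 1) →
    (∀ h, 0 ≤ cHub P h) ∧ (∀ h, 3 * P.length < h → cHub P h = 0) ∧
      ∑ h ∈ Finset.range (3 * P.length + 1), cHub P h = 1 ∧
      ∑ h ∈ Finset.range (3 * P.length + 1), (h : ℝ) * cHub P h = (P.map (fun γ => 1 + 2 * γ)).sum
  | [], _ => by
    refine ⟨fun h => ?_, fun h hh => ?_, ?_, ?_⟩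
    · show (0 : ℝ) ≤ (if h = 0 then (1 : ℝ) else 0); split_ifs <;> norm_num
    · show (if h = 0 then (1 : ℝ) else 0) = 0; rw [if_neg (by simp at hh; omega)]
    · simp [cHub]
    · simp [cHub]
  | γ :: P, hP => by
    have hγ := hP γ (by simp)
    have hP' : ∀ γ' ∈ P, 0 ≤ γ' ∧ γ' ≤ 1 := fun γ' h' => hP γ' (List.mem_cons_of_mem γ h')
    obtain ⟨a0, _, a1, am⟩ := cHub_laws P hP'
    obtain ⟨c0, _, c1, cm⟩ := cp_laws hγ.1 hγ.2
    obtain ⟨b0, bM, b1, bm⟩ := lconv_laws a0 a1 am c0 c1 cm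
    have eT : 3 * (γ :: P).length = 3 * P.length + 3 := by simp [List.length_cons]; ring
    simp only [cHub, List.map_cons, List.sum_cons]
    rw [eT]
    refine ⟨b0, bM, b1, ?_⟩
    rw [bm]; ring

/-- **structure of the hub** for `o ≥ 0` with `o(1−γ) ≤ γ` for every `γ ∈ P` (`o ≤` every odds): SUPPORT — a charged atom is `|P| + 2s` with
`s ≤ |P|` — and LIKELIHOOD-RATIO DOMINANCE — `o·(3|P| − h)·u(h) ≤ (h + 2 − |P|)·u(h+2)` for every `h`. [this work] -/
theorem cHub_struct (o : ℝ) (ho : 0 ≤ o) : ∀ P : List ℝ, (∀ γ ∈ P, 0 ≤ γ ∧ γ ≤ 1 ∧ o * (1 - γ) ≤ γ) →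
    (∀ h, cHub P h ≠ 0 → ∃ s, h = P.length + 2 * s ∧ s ≤ P.length) ∧
    (∀ h : ℕ, o * (3 * (P.length : ℝ) - h) * cHub P h ≤ ((h : ℝ) + 2 - P.length) * cHub P (h + 2))
  | [], _ => by
    have hdef : cHub [] = δ[0] := rfl
    refine ⟨fun h hh => ⟨0, ?_, le_rfl⟩, fun h => ?_⟩
    · have h0 : h = 0 := by
        by_contra hne
        exact hh (by rw [hdef]; exact if_neg hne)
      subst h0; simp
    · rw [hdef]
      have e2 : (if h + 2 = (0 : ℕ) then (1 : ℝ) else 0) = 0 := if_neg (by omega)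
      simp only [e2, mul_zero, List.length_nil, Nat.cast_zero]
      by_cases h0 : h = 0
      · subst h0; simp
      · rw [if_neg h0, mul_zero]
  | γ :: P, hP => by
    have hγ := hP γ (by simp)
    have hP' : ∀ γ' ∈ P, 0 ≤ γ' ∧ γ' ≤ 1 ∧ o * (1 - γ') ≤ γ' := fun γ' h' => hP γ' (List.mem_cons_of_mem γ h')
    obtain ⟨hsupp, hlr⟩ := cHub_struct o ho P hP'
    obtain ⟨a0, aM, _, _⟩ := cHub_laws P (fun γ' h' => ⟨(hP' γ' h').1, (hP' γ' h').2.1⟩)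
    set j : ℕ := P.length with hj
    set μ : ℕ → ℝ := cHub P with hμ
    have hdef : cHub (γ :: P) = lconv (3 * j) 3 μ CP[γ] := rfl
    have happ : ∀ h, cHub (γ :: P) h = (1 - γ) * (if 1 ≤ h then μ (h - 1) else 0) + γ * (if 3 ≤ h then μ (h - 3) else 0) :=
      fun h => by rw [hdef]; exact lconv_cp_apply (3 * j) μ γ aM h
    have hlen : (γ :: P).length = j + 1 := by simp [hj]
    refine ⟨fun h hh => ?_, fun h => ?_⟩
    · -- support
      rw [happ] at hh
      by_cases hA : (if 1 ≤ h then μ (h - 1) else 0) = 0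
      · rw [hA, mul_zero, zero_add] at hh
        have hB : (if 3 ≤ h then μ (h - 3) else 0) ≠ 0 := fun e => hh (by rw [e, mul_zero])
        have h3 : 3 ≤ h := by by_contra hc; exact hB (if_neg hc)
        rw [if_pos h3] at hB
        obtain ⟨s, hs, hsj⟩ := hsupp (h - 3) hB
        exact ⟨s + 1, by rw [hlen]; omega, by rw [hlen]; omega⟩
      · have h1 : 1 ≤ h := by by_contra hc; exact hA (if_neg hc)
        rw [if_pos h1] at hA
        obtain ⟨s, hs, hsj⟩ := hsupp (h - 1) hA
        exact ⟨s, by rw [hlen]; omega, by rw [hlen]; omega⟩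
    · -- likelihood-ratio dominance
      set A : ℝ := (if 1 ≤ h then μ (h - 1) else 0) with hA
      set B : ℝ := (if 3 ≤ h then μ (h - 3) else 0) with hB
      set C : ℝ := μ (h + 1) with hC
      have e1 : cHub (γ :: P) h = (1 - γ) * A + γ * B := happ h
      have e2 : cHub (γ :: P) (h + 2) = (1 - γ) * C + γ * A := by
        rw [happ (h + 2), if_pos (show 1 ≤ h + 2 by omega), show h + 2 - 1 = h + 1 by omega]
        congr 2
        by_cases h1 : 1 ≤ h
        · rw [hA, if_pos h1, if_pos (show 3 ≤ h + 2 by omega), show h + 2 - 3 = h - 1 by omega]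
        · rw [hA, if_neg h1, if_neg (show ¬ (3 ≤ h + 2) by omega)]
      have hA0 : 0 ≤ A := by rw [hA]; split_ifs; exact a0 _; exact le_rfl
      -- (a) `o(3j + 1 − h)·A ≤ (h + 1 − j)·C`
      have fa : o * (3 * (j : ℝ) + 1 - h) * A ≤ ((h : ℝ) + 1 - j) * C := by
        by_cases h1 : 1 ≤ h
        · have := hlr (h - 1)
          have ec : ((h - 1 : ℕ) : ℝ) = (h : ℝ) - 1 := by
            rw [Nat.cast_sub h1]; simp
          rw [ec, show h - 1 + 2 = h + 1 by omega] at this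
          rw [hA, if_pos h1, hC]
          have e3 : o * (3 * (j : ℝ) + 1 - h) = o * (3 * (j : ℝ) - ((h : ℝ) - 1)) := by ring
          have e4 : ((h : ℝ) + 1 - j) = ((h : ℝ) - 1 + 2 - j) := by ring
          rw [e3, e4]; exact this
        · rw [hA, if_neg h1, mul_zero, hC]
          -- `h = 0`: `(1 − j)·μ(1) ≥ 0` since `μ 1 ≠ 0 ⟹ j = 1`
          have h0 : h = 0 := by omega
          subst h0
          rcases eq_or_ne (μ 1) 0 with hz | hnz
          · rw [show (0 : ℕ) + 1 = 1 by rfl, hz, mul_zero]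
          · obtain ⟨s, hs, hsj⟩ := hsupp 1 hnz
            have hj1 : j = 1 := by omega
            rw [hj1]; simp
      -- (b) `o(3j + 3 − h)·B ≤ (h − 1 − j)·A`
      have fb : o * (3 * (j : ℝ) + 3 - h) * B ≤ ((h : ℝ) - 1 - j) * A := by
        by_cases h3 : 3 ≤ h
        · have := hlr (h - 3)
          have ec : ((h - 3 : ℕ) : ℝ) = (h : ℝ) - 3 := by
            rw [Nat.cast_sub h3]; simp
          rw [ec, show h - 3 + 2 = h - 1 by omega] at this
          rw [hB, if_pos h3, hA, if_pos (show 1 ≤ h by omega)]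
          have e3 : o * (3 * (j : ℝ) + 3 - h) = o * (3 * (j : ℝ) - ((h : ℝ) - 3)) := by ring
          have e4 : ((h : ℝ) - 1 - j) = ((h : ℝ) - 3 + 2 - j) := by ring
          rw [e3, e4]; exact this
        · rw [hB, if_neg h3, mul_zero]
          -- `A ≠ 0 ⟹ h − 1 ≥ j`
          rcases eq_or_ne A 0 with hz | hnz
          · rw [hz, mul_zero]
          · have h1 : 1 ≤ h := by by_contra hc; exact hnz (by rw [hA, if_neg hc])
            have hA' : μ (h - 1) ≠ 0 := by rw [hA, if_pos h1] at hnz; exact hnz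
            obtain ⟨s, hs, _⟩ := hsupp (h - 1) hA'
            have : (j : ℝ) ≤ (h : ℝ) - 1 := by
              have : j + 1 ≤ h := by omega
              have : ((j : ℕ) : ℝ) + 1 ≤ h := by exact_mod_cast this
              linarith
            exact mul_nonneg (by linarith) hA0
      rw [hlen, e1, e2]
      push_cast
      have key : 0 ≤ A * (γ - o * (1 - γ)) := mul_nonneg hA0 (by linarith [hγ.2.2])
      have p1 := mul_le_mul_of_nonneg_left fa (show (0 : ℝ) ≤ 1 - γ by linarith [hγ.2.1])
      have p2 := mul_le_mul_of_nonneg_left fb hγ.1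
      nlinarith [p1, p2, key]


end LawDec
end Quant
end Summit.CriticalPhenomena.PercolationContinuityZ3.Theorems
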